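import Literature.AlgebraicGeometry.HodgeTheory.NoTypeIVTimesCMProductSpan
import Literature.AlgebraicGeometry.HodgeTheory.WeilClassesFieldHodgeSemisimpleHodgeGroup
import Literature.AlgebraicGeometry.HodgeTheory.HodgeEndomorphismsHOneOfRiemann
import Literature.AlgebraicGeometry.HodgeTheory.AbelianVarietyHodgeHomFullness
import Literature.AlgebraicGeometry.Motives.HodgeThetaDerivedTimesAbelian
import Mathlib.Algebra.DirectSum.LinearMap
import HarnessLib

/-!
# `HodgeClassesProductSpan A C` for every complex abelian variety `A` satisfying the `Θ`-TRACE CONDITION and `C` of CM type (Lombardo 2016 Lemma 3.4 with `H(A)` SEMISIMPLE; Gordon 1999 2.16 (1) + §3; Moonen–Zarhin 1999 (3.1)), and the condition PROVED for balanced multiplicities `n_σ = n_σ̄` (Moonen–Zarhin 1998 Criterion / Remark (1): every Weil-type general member)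

Family `hodge`, layer `Literature/AlgebraicGeometry/HodgeTheory`. Written for the cell `pub-hodge-ring2` (HONEST FRAMING: research route conditional on HC_CM; not a corollary; Q11.4-sentence-2 already refuted in dim ≥ 3), seat `motiv`
(gen 138; offered to LEAD as `F-motiv-g138-1`, placed here by the cell's LEAN PLACEMENT RULE: printed results with cite tags).
UNCONDITIONAL linear algebra / Hodge theory of complex abelian varieties; theorems and TWO predicates `HodgeThetaTraceCondition A`, `WeilTypeThetaTraceLink` (definitions, nothing asserted; the second has its kernel witness `weilTypeThetaTraceLink_holds` in this file); no named fact, nothing admitted;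
no step towards a summit statement beyond the printed results it formalizes (HC_CM, where it occurs, is a HYPOTHESIS).

## Mathematics

The tree proves Lombardo 2016 Lemma 3.4 in the form «`A` WITHOUT FACTOR OF TYPE IV, `B` of CM type ⟹ the Hodge
ring of `A × B` is generated by the factors» (`HodgeTheory/NoTypeIVTimesCM{Invariance,ProductSpan}.lean`, via
the Lie step `Motives/HodgeThetaAnnihilatorPerfectTimesAbelian.lean`, whose new last step is PERFECTNESS of the
corner algebra: no `ψ`-skew central Hodge endomorphism of `H¹(A)`). Lombardo's printed hypothesis is weaker:
«`H(A)` SEMISIMPLE» — abelian varieties of Weil type with `Hg = SU` are allowed. This file (with its Lie step `Motives/HodgeThetaDerivedTimesAbelian`, §§1–2 there) proves the general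
form, with «`H(A)` semisimple» in its LIE form, the `Θ`-TRACE CONDITION

  `tr(Θ_A ∘ a_ℂ) = 0` for every Rosati-skew central Hodge endomorphism `a` of `H¹(A;ℚ)`

(`Θ_A` the Hodge grading operator; for `A` of Weil type `(K, φ)` with centre of `End⁰(A)` inside `K` this is
exactly the balance `n_σ = n_σ̄`, Moonen–Zarhin 1998 §1 Remark (1); for `A` without factor of type IV it is
vacuous, `hodgeThetaTraceCondition_of_hasNoTypeIVFactor`). The only consumer of perfectness in the tree's proof
is the membership `Θ_A ∈ 𝔡(𝔤_A)_ℂ` of the grading operator in the complexified DERIVED corner algebra; §1 proves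
it from the trace condition alone: `𝔤 = 𝔷 ⊕ 𝔡(𝔤)` (`ThetaSubalgebra.center_sup_derived_eq`), write `Θ = z + s`;
`tr(s ∘ Z_ℂ) = 0` for central `Z` (`tr([X,Y]Z) = tr(X[Y,Z]) = 0`), so `z` is trace-orthogonal to `𝔷_ℂ`; by
rational radical descent (`spanC_exists_rational_radical`) a nonzero `z` would produce a rational central
`X ≠ 0` with `tr(X²) = 0`, contradicting `tr(X²) < 0` (`eq_zero_of_central_of_trace_mul_self_eq_zero`, the
`ψ`-skew central elements act through a CM field with positive Rosati form). Hence `z = 0`, `Θ ∈ 𝔡(𝔤)_ℂ`. §2 is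
the product Lie step with this last step (Goursat: `ι₁ 𝔡(𝔤₁)_ℂ π₁ ⊆ 𝔞_ℂ`); §§3–5 are the tree's geometric
files with `HasNoTypeIVFactor A` replaced by `HodgeThetaTraceCondition A` (proof text otherwise verbatim); §6
draws the consequences for `HodgeConjectureFor` with Hodge-for-CM as the fact-free hypothesis `∀ Y, Milne1999.CMHodgeHypothesisAt Y`
(the summit-side rows binding `RankFourFaces.CMAbelianHodge` by name live in
`Summits/HodgeConjecture/HodgeConjecture/Theorems/Ring2MotivThetaTraceProductCells.lean`). §7 states AND PROVES the link for the Weil-type rows of `RING2-MAP §motiv`: «`φ ∈ End(A)`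
with irreducible integral polynomial `P`, `P(φ) = 0`, every central pull-back a polynomial in `φ^*` (centre of
`End⁰(A)` `⊆ ℚ(φ)`) and BALANCED multiplicities `n_ρ = n_ρ̄` at the roots ⟹ `HodgeThetaTraceCondition A`»
(`hodgeThetaTraceCondition_of_balanced`; as the Prop `WeilTypeThetaTraceLink` with the hypotheses of the tree's
`hasSemisimpleHodgeGroup_of_forall_eigenMultiplicity_eq`, `weilTypeThetaTraceLink_holds`). Proof: a central Hodge
endomorphism `a` of `H¹(A; ℚ)` transports under `β : H¹(A; ℚ) ⊗ ℂ ≃ H¹(A(ℂ); ℂ)` to `c · F^*` (Riemann,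
`mem_endAlg_hodge_one_iff_exists_bettiRep`), which commutes with all pull-backs, hence is `p(φ^*)`; `Θ` transports
to `± 1` on `H^{1,0}`, `H^{0,1}`; on `H¹(A(ℂ); ℂ) = ⊕_ρ V_ρ` (`φ^*` semisimple) `tr(Θ ∘ a_ℂ) = Σ_ρ p(ρ)(n_ρ - n'_ρ)`
with `n'_ρ = dim (V_ρ ∩ H^{0,1}) = n_ρ̄` (`finrank_eigenspace_inf_hodgeZeroOne_eq`) `= n_ρ`. Hence the Weil-type
product row carries NO printed-fact binder (`hodgeConjectureFor_prod_weilType_of_cmHodgeHypothesis`).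

## What is bypassed and what is not reached (residuals (r1)–(r3))

* BYPASSED, NOT discharged (no `_holds`): the named fact `Gordon1999_hodgeClassesProductSpan_of_semisimple`. On the
  rows «HC_CM ∧ HC(A) ⟹ HC(A × C), `A` with the `Θ`-trace condition (in particular `A` of Weil type with centre
  `⊆ ℚ(φ)` and balanced multiplicities), `C` CM» neither `hG : Gordon1999_hodgeClassesProductSpan_of_semisimple` nor
  `hA : HasSemisimpleHodgeGroup A` is a binder: the product span is PROVED directly
  (`hodgeClassesProductSpan_of_thetaTrace_of_isOfCMType`, link `hodgeThetaTraceCondition_of_balanced`); what remains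
  on those rows is HC_CM, HC(`A`) and the data. The tree's row carrying `hG` / `hA` stands as typed.
* NOT reached: (r1) type-IV (Weil-type) classes with UNBALANCED multiplicities somewhere (`Hg` has a non-trivial
  central torus; the trace condition fails); (r2) non-isotypic `A` whose centre is a product of fields (a
  multi-generator version of the link is not written); (r3) the named fact
  `Gordon1999_hodgeClassesProductSpan_of_semisimple` AS TYPED (hypothesis `HasSemisimpleHodgeGroup A` = finite centre
  of the Tannaka-free carrier; «finite centre ⟹ trace condition» needs connectedness of `Hg`, not in the tree) —
  BYPASSED on the `Θ`-trace class, NOT discharged; and HC for `A` of Weil type itself (outside the refereed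
  Markman / Schoen / van Geemen / Koike / Floccari–Fu rows it stays a hypothesis `HodgeConjectureFor A.dim A.X`).

## References

* [Lombardo2016] D. Lombardo, *On the ℓ-adic Galois representations attached to nonsimple abelian varieties*,
  Ann. Inst. Fourier 66 (2016), Lemma 3.2, Lemma 3.4, Remark 3.5 (p. 1229). [cite: Lombardo2016, Lemma 3.4 (p. 1229)]
* [MoonenZarhin1998WeilClasses] B. Moonen, Yu. Zarhin, *Weil classes on abelian varieties*, J. reine angew.
  Math. 496 (1998), §1 Criterion and Remark (1). [cite: MoonenZarhin1998WeilClasses, §1 Remark (1) after Criterion (2)]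
* [MoonenZarhin1999LowDim] B. Moonen, Yu. Zarhin, Duke Math. J. 98 (1999), §1, §3 (3.1).
  [cite: MoonenZarhin1999LowDim, §3 (3.1)]
* [Deligne1982HodgeCycles] P. Deligne, LNM 900 (1982), I §3 Prop. 3.4, Prop. 3.6.
  [cite: Deligne1982HodgeCycles, I §3 Prop. 3.6]
* [Gordon1999HodgeAVSurvey] B. B. Gordon, Appendix B to Lewis' *Survey* (1999), 2.16 (1), §3.
  [cite: Gordon1999HodgeAVSurvey, §3 proof of the Theorem (last step)]
* [Milne1999] J. S. Milne, Compositio 117 (1999), §7 p. 72 (the hypothesis HC_CM). [cite: Milne1999, §7 p. 72]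
* [VoisinHodgeII2003] C. Voisin, *Hodge Theory II*, proof of Prop. 9.20. [cite: VoisinHodgeII2003, proof of Prop. 9.20 (first display)]
* [DeligneMilne1982Tannakian] P. Deligne, J. S. Milne, *Tannakian categories*, LNM 900 (1982), §6 Thm. 6.20 (Riemann
  for `End`). [cite: DeligneMilne1982Tannakian, §6 Thm. 6.20]
* [vanGeemen1994HodgeAV] B. van Geemen, *An introduction to the Hodge conjecture for abelian varieties* (1994), 4.9,
  Lemma 5.2. [cite: vanGeemen1994HodgeAV, 4.9]
* [VoisinHodgeI2002] C. Voisin, *Hodge Theory I*, §7.1.1 (base change of Betti cohomology). [cite: VoisinHodgeI2002, §7.1.1]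
-/

noncomputable section

open scoped TensorProduct
open CategoryTheory Module

/-! ## Geometric files of programme R5 with `HasNoTypeIVFactor A` replaced by `HodgeThetaTraceCondition A` -/

namespace Literature.AlgebraicGeometry.HodgeTheory

open Literature.AlgebraicTopology.SingularHomology
open Literature.AlgebraicGeometry.Motives (IsSmoothProjective AbelianVariety bettiCohomology
  ofRatClassBaseChange ofRatClassBaseChange_tmul HodgeTensorFacts hodgeTensorFacts_holds ComplexPoints)
open Literature.Barriers.HodgeConjecture
open Literature.AlgebraicGeometry.Motives.HodgeStructure
open Literature.AlgebraicGeometry.ComplexMultiplication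
open Literature.RepresentationTheory.GeneralLinear
open Literature.NumberTheory.DiophantineGeometry

/-! ### §3 The `Θ`-trace condition of a complex abelian variety -/

section Bridge

variable {A : AbelianVariety ℂ}

/-- **The `Θ`-trace condition of `A`** on the tree's canonical rational Hodge structure `H¹(A(ℂ); ℚ)`
(`BettiUniverse.hodge`): `tr(Θ_A ∘ a_ℂ) = 0` for every Rosati-skew central Hodge endomorphism `a` of `H¹(A; ℚ)`
and every polarization — the Lie form of «`Hg(A)` is semisimple». [cite: MoonenZarhin1998WeilClasses, §1 Remark (1)
after Criterion (2)] [cite: Deligne1982HodgeCycles, I §3 Prop. 3.6] -/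
def HodgeThetaTraceCondition (A : AbelianVariety ℂ) : Prop :=
  (BettiUniverse.hodge exists_isReal_hodgeModel_holds (AbelianVariety.isSmoothProjective_holds (A := A)) 1).ThetaTraceCondition

/-- **No factor of type IV ⟹ the `Θ`-trace condition** (vacuously: there is no nonzero Rosati-skew central Hodge
endomorphism, `forall_central_skew_eq_zero_hodge_one_of_hasNoTypeIVFactor`). [cite: MoonenZarhin1999LowDim, §1] -/
theorem hodgeThetaTraceCondition_of_hasNoTypeIVFactor (hA4 : HasNoTypeIVFactor A) : HodgeThetaTraceCondition A := by
  haveI : HodgeTensorFacts.{0, 0} := hodgeTensorFacts_holds.{0, 0}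
  exact thetaTraceCondition_of_forall_central_skew_eq_zero _ fun ψ =>
    forall_central_skew_eq_zero_hodge_one_of_hasNoTypeIVFactor hA4 exists_isReal_hodgeModel_holds
      hodgePQ_independent_of_hodgeModel_holds ψ

end Bridge

/-! ### §4 The invariance theorem for slots over `A × C` -/

section Invariance

variable {A C X : AbelianVariety ℂ} {n : ℕ} {g : Fin n → (X ⟶ A.prod C)}

/-- The two elements of `Fin 2`. [folklore] -/
private theorem fin2_eq_zero_or_one''' (r : Fin 2) : r = 0 ∨ r = 1 := by
  fin_cases r <;> simp

open scoped Classical in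
/-- **The INVARIANCE THEOREM for slots over `A × C`, `A` with the `Θ`-TRACE CONDITION, `C` of CM type
(Lombardo 2016 Lemma 3.4 with `H(A)` semisimple / Moonen–Zarhin 1999 (3.1), Lie step).** The tree's
`AVSlots.exists_coeff_eq_zero_off_balanced_of_prod_noTypeIV_cmType` with its hypothesis `HasNoTypeIVFactor A`
REPLACED by `HodgeThetaTraceCondition A` (`tr(Θ_A ∘ a_ℂ) = 0` for every Rosati-skew central Hodge endomorphism
`a` of `H¹(A;ℚ)`; type IV ALLOWED, e.g. `A` of Weil type with `n_σ = n_σ̄`): there are Hodge-adapted pair bases of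
`H¹(A) ⊗ ℂ` and `H¹(C) ⊗ ℂ` such that every rational `(p,p)`-class on `X` (slots `g` over `A × C`) has a letter
expansion whose coefficient function VANISHES off the `A`-kind-balanced words — the tensor invariants of `X`
are invariants of `Θ_A ⊕ 0`. Proof = the tree's proof verbatim, the Lie step now
`wordDerAt_incl_theta_proj_eq_zero_of_thetaTrace_times_abelian`.
[cite: Lombardo2016, Lemma 3.4 (p. 1229)] [cite: MoonenZarhin1999LowDim, §3 (3.1)]
[cite: MoonenZarhin1998WeilClasses, §1 Remark (1) after Criterion (2)] [cite: Deligne1982HodgeCycles, I §3 Prop. 3.4] -/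
theorem AVSlots.exists_coeff_eq_zero_off_balanced_of_prod_thetaTrace_cmType (hg : AVSlots (A.prod C) X g)
    (hB : HodgeThetaTraceCondition A) (hC : Milne1999.IsOfCMType C) :
    ∃ (hA : ℕ) (bA : Module.Basis (Fin hA × Fin 2) ℂ (ℂ ⊗[ℚ] bettiCohomology A.X 1))
      (h : ℕ) (cC : Module.Basis (Fin h × Fin 2) ℂ (ℂ ⊗[ℚ] bettiCohomology C.X 1)),
      (∀ i, IsOfHodgeType A.dim A.X 1 1 0 (ofRatClassBaseChange (Motives.ComplexPoints A.X) 1 (bA (i, 0)))) ∧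
      (∀ i, IsOfHodgeType A.dim A.X 1 0 1 (ofRatClassBaseChange (Motives.ComplexPoints A.X) 1 (bA (i, 1)))) ∧
      (∀ i, IsOfHodgeType C.dim C.X 1 1 0 (ofRatClassBaseChange (Motives.ComplexPoints C.X) 1 (cC (i, 0)))) ∧
      (∀ i, IsOfHodgeType C.dim C.X 1 0 1 (ofRatClassBaseChange (Motives.ComplexPoints C.X) 1 (cC (i, 1)))) ∧
      ∀ {p : ℕ}, 0 < p → ∀ {c : complexBetti X.X (2 * p)}, IsRationalClass c →
        IsOfHodgeType X.dim X.X (2 * p) p p c →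
        ∃ a : (Fin (2 * p) → (Fin n × (Fin hA ⊕ Fin h)) × Fin 2) → ℂ,
          wordEval (cupPowOneAlt ℂ (Motives.ComplexPoints X.X) (2 * p))
            (fun jr : (Fin n × (Fin hA ⊕ Fin h)) × Fin 2 => complexBetti.map (g jr.1.1).hom.hom.hom 1
              (Sum.elim
                (fun i => complexBetti.map (Motives.AbelianVariety.fst A C).hom.hom.hom 1
                  (ofRatClassBaseChange (Motives.ComplexPoints A.X) 1 (bA (i, jr.2))))
                (fun i => complexBetti.map (Motives.AbelianVariety.snd A C).hom.hom.hom 1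
                  (ofRatClassBaseChange (Motives.ComplexPoints C.X) 1 (cC (i, jr.2))))
                jr.1.2)) a = c ∧
          ∀ (U : Fin (2 * p) → Fin n × (Fin hA ⊕ Fin h)) (η : Fin (2 * p) → Fin 2),
            (∑ t, Sum.elim (fun _ : Fin hA => if η t = 0 then (1 : ℂ) else -1) (fun _ : Fin h => (0 : ℂ)) (U t).2) ≠ 0 →
            a (fun t => (U t, η t)) = 0 := by
  classical
  -- the setting
  have hHD : exists_isReal_hodgeModel := exists_isReal_hodgeModel_holds
  have hI : hodgePQ_independent_of_hodgeModel := hodgePQ_independent_of_hodgeModel_holds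
  haveI : HodgeTensorFacts.{0, 0} := hodgeTensorFacts_holds.{0, 0}
  have hXA : IsSmoothProjective A.dim A.X := AbelianVariety.isSmoothProjective_holds
  have hXC : IsSmoothProjective C.dim C.X := AbelianVariety.isSmoothProjective_holds
  have hXP : IsSmoothProjective (A.prod C).dim (A.prod C).X := AbelianVariety.isSmoothProjective_holds
  haveI : Module.Finite ℚ (bettiCohomology A.X 1) := finite_bettiCohomology_one A
  haveI : Module.Finite ℚ (bettiCohomology C.X 1) := finite_bettiCohomology_one C
  haveI : Module.Finite ℚ (bettiCohomology (A.prod C).X 1) := finite_bettiCohomology_one (A.prod C)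
  have hn1 : (((1 : ℕ) : ℤ)) = 1 := by norm_num
  -- the pair bases of `H¹(A) ⊗ ℂ` and `H¹(C) ⊗ ℂ`
  obtain ⟨hA, bA, hbA0, hbA1⟩ := exists_hodgeAdapted_pairBasis (BettiUniverse.hodge hHD hXA 1) (by norm_num)
    (BettiUniverse.hodge_isEffective hHD hXA 1)
  have hbA0' : ∀ i, bA (i, 0) ∈ (BettiUniverse.hodge hHD hXA 1).piece 1 0 := fun i => by simpa using hbA0 i
  have hbA1' : ∀ i, bA (i, 1) ∈ (BettiUniverse.hodge hHD hXA 1).piece 0 1 := fun i => by simpa using hbA1 i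
  obtain ⟨h, cC, hcC0, hcC1⟩ := exists_hodgeAdapted_pairBasis (BettiUniverse.hodge hHD hXC 1) (by norm_num)
    (BettiUniverse.hodge_isEffective hHD hXC 1)
  have hcC0' : ∀ i, cC (i, 0) ∈ (BettiUniverse.hodge hHD hXC 1).piece 1 0 := fun i => by simpa using hcC0 i
  have hcC1' : ∀ i, cC (i, 1) ∈ (BettiUniverse.hodge hHD hXC 1).piece 0 1 := fun i => by simpa using hcC1 i
  refine ⟨hA, bA, h, cC, fun i => ?_, fun i => ?_, fun i => ?_, fun i => ?_, ?_⟩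
  · exact (BettiUniverse.mem_hodge_piece_iff hHD hI hXA (k := 1) (p := 1) (q := 0) rfl _).1 (hbA0' i)
  · exact (BettiUniverse.mem_hodge_piece_iff hHD hI hXA (k := 1) (p := 0) (q := 1) rfl _).1 (hbA1' i)
  · exact (BettiUniverse.mem_hodge_piece_iff hHD hI hXC (k := 1) (p := 1) (q := 0) rfl _).1 (hcC0' i)
  · exact (BettiUniverse.mem_hodge_piece_iff hHD hI hXC (k := 1) (p := 0) (q := 1) rfl _).1 (hcC1' i)
  intro p hp c hcQ hc
  -- the presentation `H¹(A × C) = pr_A^* H¹(A) ⊕ pr_C^* H¹(C)` and its complexification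
  set ι₁ := HOneProduct.pullFst A C with hι₁
  set π₁ := HOneProduct.pullInl A C with hπ₁
  set ι₂ := HOneProduct.pullSnd A C with hι₂
  set π₂ := HOneProduct.pullInr A C with hπ₂
  have hπι₁ : π₁ ∘ₗ ι₁ = LinearMap.id := HOneProduct.pullInl_comp_pullFst
  have hπι₂ : π₂ ∘ₗ ι₂ = LinearMap.id := HOneProduct.pullInr_comp_pullSnd
  have hπ₁ι₂ : π₁ ∘ₗ ι₂ = 0 := HOneProduct.pullInl_comp_pullSnd
  have hπ₂ι₁ : π₂ ∘ₗ ι₁ = 0 := HOneProduct.pullInr_comp_pullFst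
  have hsum : ι₁ ∘ₗ π₁ + ι₂ ∘ₗ π₂ = LinearMap.id := HOneProduct.pullFst_comp_pullInl_add
  have hπι₁C : π₁.baseChange ℂ ∘ₗ ι₁.baseChange ℂ = LinearMap.id := by
    rw [← LinearMap.baseChange_comp, hπι₁, LinearMap.baseChange_id]
  have hπι₂C : π₂.baseChange ℂ ∘ₗ ι₂.baseChange ℂ = LinearMap.id := by
    rw [← LinearMap.baseChange_comp, hπι₂, LinearMap.baseChange_id]
  have hπ₁ι₂C : π₁.baseChange ℂ ∘ₗ ι₂.baseChange ℂ = 0 := by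
    rw [← LinearMap.baseChange_comp, hπ₁ι₂, LinearMap.baseChange_zero]
  have hπ₂ι₁C : π₂.baseChange ℂ ∘ₗ ι₁.baseChange ℂ = 0 := by
    rw [← LinearMap.baseChange_comp, hπ₂ι₁, LinearMap.baseChange_zero]
  have hsumC : ι₁.baseChange ℂ ∘ₗ π₁.baseChange ℂ + ι₂.baseChange ℂ ∘ₗ π₂.baseChange ℂ = LinearMap.id := by
    rw [← LinearMap.baseChange_comp, ← LinearMap.baseChange_comp, ← LinearMap.baseChange_add, hsum,
      LinearMap.baseChange_id]
  -- piece compatibility of `pr_A^*`, `pr_C^*` (pull-backs are morphisms of Hodge structures)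
  have hι₁F : ∀ q : ℤ, ∀ x ∈ (BettiUniverse.hodge hHD hXA 1).piece q (((1 : ℕ) : ℤ) - q), ι₁.baseChange ℂ x ∈ (BettiUniverse.hodge hHD hXP 1).piece q (((1 : ℕ) : ℤ) - q) :=
    fun q x hx => (BettiUniverse.pullHodgeHom hHD hI hXP hXA (Motives.AbelianVariety.fst A C).hom.hom.hom 1).map_piece_le
      q _ ⟨x, hx, rfl⟩
  have hι₂F : ∀ q : ℤ, ∀ x ∈ (BettiUniverse.hodge hHD hXC 1).piece q (((1 : ℕ) : ℤ) - q), ι₂.baseChange ℂ x ∈ (BettiUniverse.hodge hHD hXP 1).piece q (((1 : ℕ) : ℤ) - q) :=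
    fun q x hx => (BettiUniverse.pullHodgeHom hHD hI hXP hXC (Motives.AbelianVariety.snd A C).hom.hom.hom 1).map_piece_le
      q _ ⟨x, hx, rfl⟩
  -- §1: the basis `cbx` of `H¹(A × C) ⊗ ℂ` in pairs: `pr_A^* b_i^r` and `pr_C^* c_i^r`
  obtain ⟨cbx', hcbx'l, hcbx'r⟩ := exists_basis_of_presentation hπι₁C hπι₂C hπ₁ι₂C hπ₂ι₁C hsumC bA cC
  set cbx : Module.Basis ((Fin hA ⊕ Fin h) × Fin 2) ℂ (ℂ ⊗[ℚ] bettiCohomology (A.prod C).X 1) :=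
    cbx'.reindex (Equiv.sumProdDistrib (Fin hA) (Fin h) (Fin 2)).symm with hcbxdef
  have hcbx : ∀ tr : (Fin hA ⊕ Fin h) × Fin 2, cbx tr =
      Sum.elim (fun i => ι₁.baseChange ℂ (bA (i, tr.2))) (fun i => ι₂.baseChange ℂ (cC (i, tr.2))) tr.1 := by
    rintro ⟨t, r⟩
    rw [hcbxdef, Module.Basis.reindex_apply, Equiv.symm_symm]
    rcases t with i | i
    · rw [Equiv.sumProdDistrib_apply_left, hcbx'l]; rfl
    · rw [Equiv.sumProdDistrib_apply_right, hcbx'r]; rfl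
  -- Hodge-adaptedness of `cbx`
  have hcbx0 : ∀ t, cbx (t, 0) ∈ (BettiUniverse.hodge hHD hXP 1).piece 1 0 := by
    intro t
    rw [hcbx]
    rcases t with i | i
    · exact hι₁F 1 _ (by simpa using hbA0' i)
    · exact hι₂F 1 _ (by simpa using hcC0' i)
  have hcbx1 : ∀ t, cbx (t, 1) ∈ (BettiUniverse.hodge hHD hXP 1).piece 0 1 := by
    intro t
    rw [hcbx]
    rcases t with i | i
    · have e : (((1 : ℕ) : ℤ) - 0) = 1 := by norm_num
      have h01 := hι₁F 0 _ (by rw [e]; exact hbA1' i)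
      rwa [e] at h01
    · have e : (((1 : ℕ) : ℤ) - 0) = 1 := by norm_num
      have h01 := hι₂F 0 _ (by rw [e]; exact hcC1' i)
      rwa [e] at h01
  -- bases indexed by `Fin M`: the pair basis `cbσ` and the rational basis `eC`
  set eQ := Module.finBasis ℚ (bettiCohomology (A.prod C).X 1) with heQ
  set eC : Module.Basis (Fin (Module.finrank ℚ (bettiCohomology (A.prod C).X 1))) ℂ
    (ℂ ⊗[ℚ] bettiCohomology (A.prod C).X 1) := Algebra.TensorProduct.basis ℂ eQ with heC
  set φ : Fin (Module.finrank ℚ (bettiCohomology (A.prod C).X 1)) ≃ (Fin hA ⊕ Fin h) × Fin 2 :=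
    eC.indexEquiv cbx with hφ
  set cbσ : Module.Basis (Fin (Module.finrank ℚ (bettiCohomology (A.prod C).X 1))) ℂ
    (ℂ ⊗[ℚ] bettiCohomology (A.prod C).X 1) := cbx.reindex φ.symm with hcbσdef
  have hcbσ : ∀ m, cbσ m = cbx (φ m) := fun m => by
    rw [hcbσdef, Module.Basis.reindex_apply, Equiv.symm_symm]
  -- letters
  set ρ := ofRatClassBaseChangeEquiv hXP 1 with hρ
  set v : Module.Basis _ ℂ (complexBetti (A.prod C).X 1) := cbσ.map ρ with hv
  set eL : Module.Basis _ ℂ (complexBetti (A.prod C).X 1) := eC.map ρ with heL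
  have heLQ : ∀ i, IsRationalClass (eL i) := fun i => by
    rw [heL, Module.Basis.map_apply, heC, Algebra.TensorProduct.basis_apply, hρ,
      ofRatClassBaseChangeEquiv_apply, ofRatClassBaseChange_tmul, one_smul]
    exact isRationalClass_ofRatClass _
  set κ : Fin (Module.finrank ℚ (bettiCohomology (A.prod C).X 1)) → Fin 2 := fun m => (φ m).2 with hκ
  have hv_apply : ∀ m, v m = ofRatClassBaseChange (Motives.ComplexPoints (A.prod C).X) 1 (cbx (φ m)) := fun m => by
    rw [hv, Module.Basis.map_apply, hcbσ, hρ, ofRatClassBaseChangeEquiv_apply]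
  have hv0 : ∀ m, κ m = 0 → IsOfHodgeType (A.prod C).dim (A.prod C).X 1 1 0 (v m) := by
    intro m hm
    rw [hv_apply, ← BettiUniverse.mem_hodge_piece_iff hHD hI hXP (k := 1) (p := 1) (q := 0) rfl]
    have hsplit : φ m = ((φ m).1, 0) := by
      change (φ m).2 = 0 at hm; rw [← hm]
    rw [hsplit]
    exact hcbx0 _
  have hv1 : ∀ m, κ m = 1 → IsOfHodgeType (A.prod C).dim (A.prod C).X 1 0 1 (v m) := by
    intro m hm
    rw [hv_apply, ← BettiUniverse.mem_hodge_piece_iff hHD hI hXP (k := 1) (p := 0) (q := 1) rfl]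
    have hsplit : φ m = ((φ m).1, 1) := by
      change (φ m).2 = 1 at hm; rw [← hm]
    rw [hsplit]
    exact hcbx1 _
  -- (α) an antisymmetric kind-balanced coefficient function in the adapted letters
  obtain ⟨ax, hax_bal, hax_anti, hcax⟩ := hg.exists_antisymm_kindBalanced_wordEval_eq v κ hv0 hv1 hp hc
  -- the change of letters to the rational letters
  set G : Matrix _ _ ℂ := eC.toMatrix cbσ with hG
  set G' : Matrix _ _ ℂ := cbσ.toMatrix eC with hG'
  have hG'G : G' * G = 1 := cbσ.toMatrix_mul_toMatrix_flip eC
  have hve : ∀ m, v m = ∑ i, G i m • eL i := fun m => by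
    simp only [hv, heL, Module.Basis.map_apply, ← map_smul, ← map_sum]
    congr 1
    exact (eC.sum_toMatrix_smul_self (v := ⇑cbσ) (j := m)).symm
  have hletters : ∀ j m, avLetters g v (j, m) = ∑ i, G i m • avLetters g eL (j, i) :=
    avLetters_baseChange g G hve
  set aE := colourChangeAt (fun _ : Fin n => G) ax with haE
  have haE_anti : IsAntisymm aE := hax_anti.colourChangeAt _
  have hcaE : wordEval (cupPowOneAlt ℂ (Motives.ComplexPoints X.X) (2 * p)) (avLetters g eL) aE = c := by
    rw [haE, ← wordEval_eq_wordEval_colourChangeAt _ (fun _ : Fin n => G) hletters ax, hcax]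
  -- rationality of `aE`
  have hFinj : Function.Injective (exteriorPower.alternatingMapLinearEquiv
      (cupPowOneAlt ℂ (Motives.ComplexPoints X.X) (2 * p))) :=
    injective_alternatingMapLinearEquiv_cupPowOneAlt X (2 * p)
  obtain ⟨q, hq⟩ := hg.exists_rat_wordEval_eq eL heLQ hcQ
  obtain ⟨q', -, haEq⟩ := haE_anti.exists_eq_algebraMap_of_wordEval_eq hFinj (hg.letterBasis eL)
    (q := q) (by rw [AVSlots.coe_letterBasis, hcaE, hq])
  have hslice_e : ∀ u, wordSlice aE u = wordRepAt ℂ (fun _ : Fin (2 * p) => G) (wordSlice ax u) :=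
    fun u => wordSlice_colourChangeAt (fun _ : Fin n => G) ax u
  -- the Hodge operator `Θ` of `H¹(A × C)`: `diag(±1)` in the adapted letters
  obtain ⟨Θ, hΘ⟩ := exists_hodgeTheta (BettiUniverse.hodge hHD hXP 1)
  have hΘb : ∀ m, Θ (cbσ m) = (if κ m = 0 then (1 : ℂ) else -1) • cbσ m := by
    intro m
    rw [hcbσ]
    change Θ _ = (if (φ m).2 = 0 then (1 : ℂ) else -1) • _
    rcases fin2_eq_zero_or_one''' (φ m).2 with h0 | h1
    · rw [h0, if_pos rfl]
      have hmem : cbx (φ m) ∈ (BettiUniverse.hodge hHD hXP 1).piece 1 (((1 : ℕ) : ℤ) - 1) := by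
        have e : (((1 : ℕ) : ℤ) - 1) = 0 := by norm_num
        have hsplit : φ m = ((φ m).1, 0) := by rw [← h0]
        rw [e, hsplit]; exact hcbx0 _
      rw [hΘ 1 _ hmem]
      norm_num
    · rw [h1, if_neg one_ne_zero]
      have hmem : cbx (φ m) ∈ (BettiUniverse.hodge hHD hXP 1).piece 0 (((1 : ℕ) : ℤ) - 0) := by
        have e : (((1 : ℕ) : ℤ) - 0) = 1 := by norm_num
        have hsplit : φ m = ((φ m).1, 1) := by rw [← h1]
        rw [e, hsplit]; exact hcbx1 _
      rw [hΘ 0 _ hmem]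
      norm_num
  have hΘcb : LinearMap.toMatrix cbσ cbσ Θ = kindDiag κ := by
    ext i m
    rw [LinearMap.toMatrix_apply, hΘb, map_smul, Module.Basis.repr_self, Finsupp.smul_apply,
      Finsupp.single_apply, kindDiag, Matrix.diagonal_apply, smul_eq_mul, mul_ite, mul_one, mul_zero]
    by_cases him : i = m
    · subst him; rw [if_pos rfl]
    · rw [if_neg (Ne.symm him), if_neg him]
  have hJG : LinearMap.toMatrix eC eC Θ * G = G * kindDiag κ := by
    rw [← hΘcb, hG, linearMap_toMatrix_mul_basis_toMatrix, basis_toMatrix_mul_linearMap_toMatrix]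
  have hΘq : ∀ u : Fin (2 * p) → Fin n, wordDerAt ℂ (fun _ : Fin (2 * p) => LinearMap.toMatrix eC eC Θ)
      (wordSlice (fun w => algebraMap ℚ ℂ (q' w)) u) = 0 := by
    intro u
    rw [← haEq, hslice_e]
    refine wordDerAt_wordRepAt_eq_zero_of_mul_eq ℂ (fun _ : Fin (2 * p) => G) (fun _ => hJG) ?_
    rw [wordDerAt_const]
    exact wordDer_kindDiag_wordSlice_eq_zero κ hax_bal u
  -- the CM commutant of `C` and Riemann: the Hodge endomorphisms `s^*`, `s ∈ S`
  obtain ⟨S, hScomm, hSF⟩ := IsOfCMType.exists_commutant_comm hC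
  set aF₂ : S → (BettiUniverse.hodge hHD hXC 1).endAlg := fun s =>
    ⟨MulOpposite.unop (bettiRep C (s : C.endAlgebra)), unop_bettiRep_mem_endAlg hHD hI (s : C.endAlgebra)⟩ with haF₂
  have hF₂ : ∀ Y Y' : Module.End ℚ (bettiCohomology C.X 1),
      (∀ s, Y * (aF₂ s : Module.End ℚ (bettiCohomology C.X 1)) = (aF₂ s : Module.End ℚ (bettiCohomology C.X 1)) * Y) →
      (∀ s, Y' * (aF₂ s : Module.End ℚ (bettiCohomology C.X 1)) = (aF₂ s : Module.End ℚ (bettiCohomology C.X 1)) * Y') →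
      Y * Y' = Y' * Y :=
    fun Y Y' hY hY' => hSF Y Y' (fun s => hY s) (fun s => hY' s)
  -- a polarization of `H¹(A)` (the `Θ`-trace condition `hB` is applied to it below)
  obtain ⟨ψ⟩ : (BettiUniverse.hodge hHD (AbelianVariety.isSmoothProjective_holds (A := A)) 1).IsPolarizable :=
    smoothProjective_hodgeStructure_isPolarizable_holds hXA (BettiUniverse.realHodgeModel hHD hXA)
      (BettiUniverse.realHodgeModel_isHodgeSymmetric hHD hXA) 1
  -- the Hodge operator `Θ_A` of `H¹(A)` and the partial Hodge operator `Y = pr_A^* ∘ Θ_A ∘ ι_A^*`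
  obtain ⟨ΘA, hΘA⟩ := exists_hodgeTheta (BettiUniverse.hodge hHD hXA 1)
  set Y := ι₁.baseChange ℂ ∘ₗ ΘA ∘ₗ π₁.baseChange ℂ with hY
  -- the product Lie step: `Y` kills the rational coefficient tensor
  have hL : ∀ u : Fin (2 * p) → Fin n, wordDerAt ℂ (fun _ : Fin (2 * p) => LinearMap.toMatrix eC eC Y)
      (wordSlice (fun w => algebraMap ℚ ℂ (q' w)) u) = 0 := fun u =>
    wordDerAt_incl_theta_proj_eq_zero_of_thetaTrace_times_abelian hn1 (BettiUniverse.hodge hHD hXP 1)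
      (BettiUniverse.hodge hHD hXA 1) (BettiUniverse.hodge hHD hXC 1) (BettiUniverse.hodge_isEffective hHD hXA 1)
      hπι₁ hπι₂ hπ₁ι₂ hπ₂ι₁ hsum hι₁F hι₂F ψ aF₂ hF₂ eQ q' hΘ hΘA (hB ψ ΘA hΘA) hΘq u
  -- the diagonal weights of `Y` in the pair letters: `±1` at the `A`-places, `0` at the `C`-places
  set δ₀ : Fin hA ⊕ Fin h → Fin 2 → ℂ :=
    Sum.elim (fun (_ : Fin hA) (r : Fin 2) => if r = 0 then (1 : ℂ) else -1) (fun (_ : Fin h) (_ : Fin 2) => (0 : ℂ))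
    with hδ₀
  set D : Fin hA ⊕ Fin h → Matrix (Fin 2) (Fin 2) ℂ := fun t => Matrix.diagonal (δ₀ t) with hD
  have hYG : ∀ _t : Fin (2 * p), LinearMap.toMatrix eC eC Y * G = G * LinearMap.toMatrix cbσ cbσ Y :=
    fun _ => by rw [hG, linearMap_toMatrix_mul_basis_toMatrix, basis_toMatrix_mul_linearMap_toMatrix]
  have e11 : ∀ x, π₁.baseChange ℂ (ι₁.baseChange ℂ x) = x := fun x => by
    rw [← LinearMap.comp_apply (f := π₁.baseChange ℂ), hπι₁C, LinearMap.id_apply]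
  have e12 : ∀ y, π₁.baseChange ℂ (ι₂.baseChange ℂ y) = 0 := fun y => by
    rw [← LinearMap.comp_apply (f := π₁.baseChange ℂ), hπ₁ι₂C, LinearMap.zero_apply]
  -- `Θ_A` on the pair basis of `H¹(A) ⊗ ℂ`
  have hΘAb : ∀ (i : Fin hA) (r : Fin 2), ΘA (bA (i, r)) = (if r = 0 then (1 : ℂ) else -1) • bA (i, r) := by
    intro i r
    rcases fin2_eq_zero_or_one''' r with h0 | h1
    · rw [h0, if_pos rfl]
      have hmem : bA (i, 0) ∈ (BettiUniverse.hodge hHD hXA 1).piece 1 (((1 : ℕ) : ℤ) - 1) := by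
        have e : (((1 : ℕ) : ℤ) - 1) = 0 := by norm_num
        rw [e]; exact hbA0' i
      rw [hΘA 1 _ hmem]
      norm_num
    · rw [h1, if_neg one_ne_zero]
      have hmem : bA (i, 1) ∈ (BettiUniverse.hodge hHD hXA 1).piece 0 (((1 : ℕ) : ℤ) - 0) := by
        have e : (((1 : ℕ) : ℤ) - 0) = 1 := by norm_num
        rw [e]; exact hbA1' i
      rw [hΘA 0 _ hmem]
      norm_num
  have hblk : LinearMap.toMatrix cbσ cbσ Y = blockLift φ D := by
    refine toMatrix_eq_blockLift_of_apply_basis φ cbσ _ Y fun m => ?_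
    rw [hcbσ m]
    have hb' : ∀ a, cbσ (φ.symm ((φ m).1, a)) = cbx ((φ m).1, a) := fun a => by
      rw [hcbσ, Equiv.apply_symm_apply]
    simp only [hb']
    obtain ⟨t, r⟩ := φ m
    rcases t with i | i
    · simp only [hcbx, Sum.elim_inl]
      rw [hY, LinearMap.comp_apply, LinearMap.comp_apply, e11, hΘAb, map_smul,
        Finset.sum_eq_single r]
      · rw [hD]
        simp only [hδ₀, Sum.elim_inl, Matrix.diagonal_apply_eq]
      · intro a _ ha
        rw [hD]
        simp only [Matrix.diagonal_apply_ne _ ha, zero_smul]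
      · intro hr; exact absurd (Finset.mem_univ r) hr
    · simp only [hcbx, Sum.elim_inr]
      rw [hY, LinearMap.comp_apply, LinearMap.comp_apply, e12, map_zero, map_zero]
      symm
      refine Finset.sum_eq_zero fun a _ => ?_
      have h0 : D (Sum.inr i) a r = 0 := by
        simp [hD, hδ₀, Matrix.diagonal_apply]
      rw [h0, zero_smul]
  -- `Y` kills the coefficient tensor in the pair letters
  have hax : ∀ u : Fin (2 * p) → Fin n, wordDerAt ℂ (fun _ : Fin (2 * p) => blockLift φ D) (wordSlice ax u) = 0 := by
    intro u
    have hLu := hL u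
    rw [← haEq, hslice_e] at hLu
    have h3 : wordRepAt ℂ (fun _ : Fin (2 * p) => G)
        (wordDerAt ℂ (fun _ : Fin (2 * p) => blockLift φ D) (wordSlice ax u)) = 0 := by
      rw [← hblk, wordRepAt_wordDerAt_of_mul_eq ℂ (fun _ : Fin (2 * p) => G) hYG, hLu]
    exact wordRepAt_injective ℂ (g := fun _ : Fin (2 * p) => G) (g' := fun _ : Fin (2 * p) => G')
      (funext fun _ => hG'G) (by rw [h3, map_zero])
  -- the coefficient function, refined to slot-and-place colours
  refine ⟨placeRefine φ ax, ?_, fun U η hU => ?_⟩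
  · rw [← hcax]
    have hx : (fun jr : (Fin n × (Fin hA ⊕ Fin h)) × Fin 2 => avLetters g v (jr.1.1, φ.symm (jr.1.2, jr.2))) =
        fun jr : (Fin n × (Fin hA ⊕ Fin h)) × Fin 2 => complexBetti.map (g jr.1.1).hom.hom.hom 1
          (Sum.elim
            (fun i => complexBetti.map (Motives.AbelianVariety.fst A C).hom.hom.hom 1
              (ofRatClassBaseChange (Motives.ComplexPoints A.X) 1 (bA (i, jr.2))))
            (fun i => complexBetti.map (Motives.AbelianVariety.snd A C).hom.hom.hom 1
              (ofRatClassBaseChange (Motives.ComplexPoints C.X) 1 (cC (i, jr.2))))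
            jr.1.2) := by
      funext jr
      rw [avLetters_apply, hv_apply, Equiv.apply_symm_apply, hcbx]
      obtain ⟨⟨j, t⟩, r⟩ := jr
      rcases t with i | i
      · simp only [Sum.elim_inl]
        congr 1
        rw [hι₁, ← ofRatClassBaseChangeEquiv_apply (hX := hXP), ← ofRatClassBaseChangeEquiv_apply (hX := hXA),
          complexBetti_map_ofRatClassBaseChangeEquiv hXP hXA]
      · simp only [Sum.elim_inr]
        congr 1
        rw [hι₂, ← ofRatClassBaseChangeEquiv_apply (hX := hXP), ← ofRatClassBaseChangeEquiv_apply (hX := hXC),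
          complexBetti_map_ofRatClassBaseChangeEquiv hXP hXC]
    rw [← hx]
    exact wordEval_placeRefine _ φ (avLetters g v) ax
  · -- the blocks of `Y` placed by place kill the refined slices; read off the diagonal weights
    have h1 := wordDerAt_placeFamily_placeRefine_eq_zero φ D hax U
    have h2 : wordDerAt ℂ (fun t => Matrix.diagonal (δ₀ (U t).2)) (wordSlice (placeRefine φ ax) U) = 0 := h1
    have h3 := eq_zero_of_wordDerAt_diagonal_eq_zero (fun t => δ₀ (U t).2) h2 η (by
      have hsum_eq : ∑ t, δ₀ (U t).2 (η t) =
          ∑ t, Sum.elim (fun _ : Fin hA => if η t = 0 then (1 : ℂ) else -1) (fun _ : Fin h => (0 : ℂ)) (U t).2 := by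
        refine Finset.sum_congr rfl fun t _ => ?_
        rw [hδ₀]
        exact sum_elim_kindWeight_apply (U t).2 (η t)
      rw [hsum_eq]; exact hU)
    rw [wordSlice_apply] at h3
    exact h3

end Invariance

/-! ### §5 `HodgeClassesProductSpan B Z` for slots over `A` with the `Θ`-trace condition and over `C` of CM type -/

section ProductSpanOpens

open MonoidalCategory CartesianMonoidalCategory

section ProductSpan

variable {A B C Z : AbelianVariety ℂ} {n : ℕ} {gB : Fin n → (B ⟶ A)} {gC : Fin n → (Z ⟶ C)}

/-- **`HodgeClassesProductSpan B Z` (Lombardo's Lemma 3.4 with `H(A)` semisimple / Moonen–Zarhin (3.1) for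
«`Θ`-trace condition × CM», PROVED with slots).** Let `A` satisfy `HodgeThetaTraceCondition A`, `C` be of CM type, `B` have `n` slots over
`A` and `Z` have `n` slots over `C` (e.g. `B = A^{N+1}`, `Z = C^{N+1}`). Then every rational class of Hodge type
`(p,p)` on `B × Z` is a `ℂ`-combination of exterior products `pr_B^* a ⌣ pr_Z^* b` of RATIONAL HODGE classes `a`
of `B` and `b` of `Z`. [cite: Lombardo2016, Lemma 3.4 (p. 1229)] [cite: MoonenZarhin1999LowDim, §3 (3.1)] -/
theorem hodgeClassesProductSpan_of_avSlots_of_thetaTrace (hT : HodgeThetaTraceCondition A)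
    (hC : Milne1999.IsOfCMType C) (hgB : AVSlots A B gB) (hgC : AVSlots C Z gC) :
    HodgeClassesProductSpan B Z := by
  classical
  intro p c hcQ hc
  have hB : IsSmoothProjective B.dim B.X := Motives.AbelianVariety.isSmoothProjective_holds
  have hZ : IsSmoothProjective Z.dim Z.X := Motives.AbelianVariety.isSmoothProjective_holds
  have hXA : IsSmoothProjective A.dim A.X := Motives.AbelianVariety.isSmoothProjective_holds
  have hXC : IsSmoothProjective C.dim C.X := Motives.AbelianVariety.isSmoothProjective_holds
  obtain ⟨hA, bA, h, cC, hbA0, hbA1, hcC0, hcC1, hmain⟩ :=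
    (hgB.prodLift hgC).exists_coeff_eq_zero_off_balanced_of_prod_thetaTrace_cmType hT hC
  have hc' : IsOfHodgeType (B.prod Z).dim (B.prod Z).X (2 * p) p p c := by
    rw [Motives.AbelianVariety.dim_prod]; exact hc
  rcases Nat.eq_zero_or_pos p with rfl | hp
  · -- degree `0`: `c = s · 1 = pr_B^*(s · 1_B) ⌣ pr_Z^* 1_Z`
    have h1 : c ∈ Submodule.span ℂ {singularCohomology.one ℂ (ComplexPoints (B.X ⊗ Z.X))} :=
      mem_divisorClassesSpan_zero (N := B.dim + Z.dim) (IsSmoothProjective.tensor_holds hB hZ) c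
    obtain ⟨s, hs⟩ := Submodule.mem_span_singleton.1 h1
    refine mem_span_hodgeProductClasses_of_mem_span_pureType B Z hcQ hc (Submodule.subset_span ?_)
    refine ⟨0, 0, rfl, s • singularCohomology.one ℂ (ComplexPoints B.X), singularCohomology.one ℂ (ComplexPoints Z.X),
      ⟨0, rfl, isOfHodgeType_zero_zero_of_degree_zero hB _⟩,
      ⟨0, 0, rfl, isOfHodgeType_zero_zero_of_degree_zero hZ _⟩, ?_⟩
    rw [← hs, map_smul, LinearMap.map_smul₂]
    erw [singularCohomology.map_one, singularCohomology.map_one, cupProduct_one]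
  · obtain ⟨a, hca, hkill⟩ := hmain hp hcQ hc'
    -- the letters of `B × Z` over `A × C` are `pr_B^*`(letters of `B` over `A`) and `pr_Z^*`(letters of `Z` over `C`)
    set xA : (Fin n × Fin hA) × Fin 2 → complexBetti B.X 1 := fun jr =>
      complexBetti.map (gB jr.1.1).hom.hom.hom 1 (ofRatClassBaseChange (ComplexPoints A.X) 1 (bA (jr.1.2, jr.2)))
      with hxA
    set y : (Fin n × Fin h) × Fin 2 → complexBetti Z.X 1 := fun jr =>
      complexBetti.map (gC jr.1.1).hom.hom.hom 1 (ofRatClassBaseChange (ComplexPoints C.X) 1 (cC (jr.1.2, jr.2)))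
      with hy
    have hletters : (fun jr : (Fin n × (Fin hA ⊕ Fin h)) × Fin 2 => complexBetti.map
        (Motives.AbelianVariety.prodLift (Motives.AbelianVariety.fst B Z ≫ gB jr.1.1)
          (Motives.AbelianVariety.snd B Z ≫ gC jr.1.1)).hom.hom.hom 1
        (Sum.elim
          (fun i => complexBetti.map (Motives.AbelianVariety.fst A C).hom.hom.hom 1
            (ofRatClassBaseChange (ComplexPoints A.X) 1 (bA (i, jr.2))))
          (fun i => complexBetti.map (Motives.AbelianVariety.snd A C).hom.hom.hom 1
            (ofRatClassBaseChange (ComplexPoints C.X) 1 (cC (i, jr.2))))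
          jr.1.2)) =
        fun jr : (Fin n × (Fin hA ⊕ Fin h)) × Fin 2 => Sum.elim
          (fun i => complexBetti.map (Motives.AbelianVariety.fst B Z).hom.hom.hom 1 (xA ((jr.1.1, i), jr.2)))
          (fun i => complexBetti.map (Motives.AbelianVariety.snd B Z).hom.hom.hom 1 (y ((jr.1.1, i), jr.2)))
          jr.1.2 := by
      funext jr
      obtain ⟨⟨j, t⟩, κ⟩ := jr
      rcases t with i | i
      · simp only [Sum.elim_inl, hxA]
        rw [complexBetti_map_map_hom, complexBetti_map_map_hom, Motives.AbelianVariety.prodLift_fst]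
      · simp only [Sum.elim_inr, hy]
        rw [complexBetti_map_map_hom, complexBetti_map_map_hom, Motives.AbelianVariety.prodLift_snd]
    -- types of the letters
    have hxA0 : ∀ jr : (Fin n × Fin hA) × Fin 2, jr.2 = 0 → IsOfHodgeType B.dim B.X 1 1 0 (xA jr) := by
      rintro ⟨⟨j, i⟩, κ⟩ hκ
      change κ = 0 at hκ
      subst hκ
      exact (hbA0 i).map_of_isSmoothProjective hB hXA _
    have hxA1 : ∀ jr : (Fin n × Fin hA) × Fin 2, jr.2 = 1 → IsOfHodgeType B.dim B.X 1 0 1 (xA jr) := by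
      rintro ⟨⟨j, i⟩, κ⟩ hκ
      change κ = 1 at hκ
      subst hκ
      exact (hbA1 i).map_of_isSmoothProjective hB hXA _
    have hy0 : ∀ jr : (Fin n × Fin h) × Fin 2, jr.2 = 0 → IsOfHodgeType Z.dim Z.X 1 1 0 (y jr) := by
      rintro ⟨⟨j, i⟩, κ⟩ hκ
      change κ = 0 at hκ
      subst hκ
      exact (hcC0 i).map_of_isSmoothProjective hZ hXC _
    have hy1 : ∀ jr : (Fin n × Fin h) × Fin 2, jr.2 = 1 → IsOfHodgeType Z.dim Z.X 1 0 1 (y jr) := by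
      rintro ⟨⟨j, i⟩, κ⟩ hκ
      change κ = 1 at hκ
      subst hκ
      exact (hcC1 i).map_of_isSmoothProjective hZ hXC _
    -- evaluate and feed the typed criterion
    have hmem := wordEval_mem_span_typed_cup_pureType_of_eq_zero_off_balanced
      (Motives.AbelianVariety.fst B Z) (Motives.AbelianVariety.snd B Z) xA y hxA0 hxA1 hy0 hy1 hkill
    rw [← hletters, hca] at hmem
    refine mem_span_hodgeProductClasses_of_mem_span_pureType B Z hcQ hc (Submodule.span_mono ?_ hmem)
    rintro z ⟨i, j, hij, d, μ, hd, hμ, rfl⟩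
    exact ⟨i, j, hij, d, μ, hd, hμ, rfl⟩

/-- **`HodgeClassesProductSpan A C` for every `A` with the `Θ`-trace condition and every `C` of CM type** (one
slot on each side) — Lombardo 2016 Lemma 3.4 (form with `H(A)` semisimple) with Moonen–Zarhin 1999 (3.1), PROVED;
type IV allowed. [cite: Lombardo2016, Lemma 3.4 (p. 1229)] [cite: MoonenZarhin1999LowDim, §3 (3.1)]
[cite: MoonenZarhin1998WeilClasses, §1 Remark (1) after Criterion (2)] -/
theorem hodgeClassesProductSpan_of_thetaTrace_of_isOfCMType (hB : HodgeThetaTraceCondition A)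
    (hC : Milne1999.IsOfCMType C) : HodgeClassesProductSpan A C :=
  hodgeClassesProductSpan_of_avSlots_of_thetaTrace hB hC (avSlots_self A) (avSlots_self C)

/-- **Equal powers**: `HodgeClassesProductSpan (A^{N+1}) (C^{N+1})` for `A` with the `Θ`-trace condition and `C`
of CM type (Moonen–Zarhin (3.1); by SLOTS `AVSlots.powSucc` on both sides — no stability of the condition under
powers is needed; unequal powers: use `hodgeClassesProductSpan_of_avSlots_of_thetaTrace` with any slot structures
of the same length, e.g. `C^{N+1}` replaced by a CM variety with `N+1` slots). [cite: MoonenZarhin1999LowDim, §3 (3.1)]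
[cite: Lombardo2016, Lemma 3.4 (p. 1229)] -/
theorem hodgeClassesProductSpan_powSucc_powSucc_of_thetaTrace (hT : HodgeThetaTraceCondition A)
    (hC : Milne1999.IsOfCMType C) (N : ℕ) : HodgeClassesProductSpan (A.powSucc N) (C.powSucc N) :=
  hodgeClassesProductSpan_of_avSlots_of_thetaTrace hT hC (AVSlots.powSucc A N) (AVSlots.powSucc C N)

/- **Sanity (the no-type-IV theorem is a case)**: `HasNoTypeIVFactor A ⟹ HodgeThetaTraceCondition A`, so the
tree's `hodgeClassesProductSpan_of_hasNoTypeIVFactor_of_isOfCMType` factors through the present theorem (an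
`example`, not a re-declaration — gate dedup). [cite: MoonenZarhin1999LowDim, §1] [cite: Lombardo2016, Lemma 3.4] -/
example (hA4 : HasNoTypeIVFactor A)
    (hC : Milne1999.IsOfCMType C) : HodgeClassesProductSpan A C :=
  hodgeClassesProductSpan_of_thetaTrace_of_isOfCMType (hodgeThetaTraceCondition_of_hasNoTypeIVFactor hA4) hC

end ProductSpan

end ProductSpanOpens

/-! ### §6 Consequences for the Hodge conjecture (HC_CM a hypothesis) -/

section Consequences

variable {A C : AbelianVariety ℂ}

/-- **HC(`A × C`) ⟺ HC(`A`) ∧ HC(`C`)** for `A` with the `Θ`-trace condition and `C` of CM type.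
[cite: Lombardo2016, Lemma 3.4 (p. 1229)] [cite: VoisinHodgeII2003, proof of Prop. 9.20 (first display)] -/
theorem hodgeConjectureFor_prod_iff_of_thetaTrace_of_isOfCMType (A C : AbelianVariety ℂ)
    (hB : HodgeThetaTraceCondition A) (hCt : Milne1999.IsOfCMType C) :
    HodgeConjectureFor (A.prod C).dim (A.prod C).X ↔
      HodgeConjectureFor A.dim A.X ∧ HodgeConjectureFor C.dim C.X :=
  hodgeConjectureFor_prod_iff_of_productSpan A C (hodgeClassesProductSpan_of_thetaTrace_of_isOfCMType hB hCt)

/-- **HC_CM ⟹ HC(`A × C`) for `A` with the `Θ`-trace condition satisfying HC and `C` of CM type** (HONEST FRAMING: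
research route conditional on HC_CM; not a corollary; Q11.4-sentence-2 already refuted in dim ≥ 3; `hCM` is Milne's
per-variety HC_CM, an explicit hypothesis used once, at `C`). [cite: Lombardo2016, Lemma 3.4 (p. 1229)]
[cite: Milne1999, §7 p. 72] -/
theorem hodgeConjectureFor_prod_of_thetaTrace_of_cmHodgeHypothesis
    (hCM : ∀ Y : AbelianVariety ℂ, Milne1999.CMHodgeHypothesisAt Y) (A C : AbelianVariety ℂ)
    (hB : HodgeThetaTraceCondition A) (hCt : Milne1999.IsOfCMType C) (hA : HodgeConjectureFor A.dim A.X) :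
    HodgeConjectureFor (A.prod C).dim (A.prod C).X :=
  hodgeConjectureFor_prod_of_productSpan A C (hodgeClassesProductSpan_of_thetaTrace_of_isOfCMType hB hCt) hA
    (hCM C AbelianVariety.isSmoothProjective_holds hCt)

/-- **HC_CM ⟹ HC(`A^{N+1} × C^{N+1}`)** for `A` with the `Θ`-trace condition, HC(`A^{N+1}`), `C` of CM type.
[cite: MoonenZarhin1999LowDim, §3 (3.1)] [cite: Milne1999, §7 p. 72] -/
theorem hodgeConjectureFor_powSucc_prod_powSucc_of_thetaTrace_of_cmHodgeHypothesis
    (hCM : ∀ Y : AbelianVariety ℂ, Milne1999.CMHodgeHypothesisAt Y) (A C : AbelianVariety ℂ)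
    (hB : HodgeThetaTraceCondition A) (hCt : Milne1999.IsOfCMType C) (N : ℕ)
    (hA : HodgeConjectureFor (A.powSucc N).dim (A.powSucc N).X) :
    HodgeConjectureFor ((A.powSucc N).prod (C.powSucc N)).dim ((A.powSucc N).prod (C.powSucc N)).X :=
  hodgeConjectureFor_prod_of_productSpan _ _ (hodgeClassesProductSpan_powSucc_powSucc_of_thetaTrace hB hCt N) hA
    (hCM _ AbelianVariety.isSmoothProjective_holds (isOfCMType_powSucc hCt N))

/-- **On path**: the Hodge conjecture gives every target of this file. [cite: Deligne2000, §1] -/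
theorem hodgeConjectureFor_prod_of_hodgeConjecture'
    (h : ∀ ⦃n : ℕ⦄ ⦃X : Motives.SchemeOver ℂ⦄, Motives.IsSmoothProjective n X → HodgeConjectureFor n X)
    (A C : AbelianVariety ℂ) : HodgeConjectureFor (A.prod C).dim (A.prod C).X :=
  h AbelianVariety.isSmoothProjective_holds

end Consequences

/-! ### §7 The link for abelian varieties of Weil type / balanced multiplicities (a Prop AND its proof) -/

section WeilTypeLink

open Polynomial
open Literature.AlgebraicGeometry.VanGeemen1994 (pullbackOne)
open Literature.AlgebraicGeometry.Milne1999 (centralizerAlgebra)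

/-- **THE WEIL-TYPE LINK, as a Prop** (rows below are stated against it; it is PROVED in this section,
`weilTypeThetaTraceLink_holds`). For Weil-type data as in the tree's `hasSemisimpleHodgeGroup_of_forall_eigenMultiplicity_eq`
— `φ ∈ End(A)` with monic irreducible integral polynomial `P` of degree `e`, `P(φ) = 0`, `e · 2m = 2 dim A`, `m ≠ 0`,
every central pull-back a polynomial in `φ^*` («`E ⊆ F′ = ℚ(φ)`»), and BALANCED multiplicities `n_ρ = n_ρ̄` at every
root — the `Θ`-trace condition holds (Moonen–Zarhin 1998 §1 Remark (1); Deligne's computation of `Lie MT` for Weil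
type). [cite: MoonenZarhin1998WeilClasses, §1 Criterion and Remark (1) after Criterion (2)]
[cite: Deligne1982HodgeCycles, I §4 Prop. 4.4 and its proof] -/
def WeilTypeThetaTraceLink : Prop :=
  ∀ (A : AbelianVariety ℂ) (φ : A ⟶ A) (P : Polynomial ℤ) (e m : ℕ), P.Monic → P.natDegree = e →
    Irreducible (P.map (Int.castRingHom ℚ)) →
    Polynomial.eval₂ (Int.castRingHom (CategoryTheory.End A)) (φ : CategoryTheory.End A) P = 0 →
    e * (2 * m) = 2 * A.dim → m ≠ 0 →
    (∀ u : A ⟶ A, pullbackOne A u ∈ centralizerAlgebra A → pullbackOne A u ∈ Algebra.adjoin ℂ {pullbackOne A φ}) →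
    (∀ ρ : ℂ, Polynomial.eval₂ (Int.castRingHom ℂ) ρ P = 0 →
      eigenMultiplicity A φ ρ = eigenMultiplicity A φ (starRingEnd ℂ ρ)) →
    HodgeThetaTraceCondition A

variable {A : AbelianVariety ℂ}

/-- **Transport of a Hodge endomorphism of `H¹(A; ℚ)` to `H¹(A(ℂ); ℂ)`**: under `β : H¹(A;ℚ) ⊗ ℂ ≃ H¹(A(ℂ);ℂ)`
(`ofRatClassBaseChangeEquiv`), `β ∘ a_ℂ ∘ β⁻¹ = c · F^*` for some `c ∈ ℚ` and `F ∈ End A` (Riemann: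
`mem_endAlg_hodge_one_iff_exists_bettiRep`, `exists_unop_bettiRep_eq_smul_pull`), and it commutes with every pull-back
`v^*` as soon as `a` is central in `End_Hdg(H¹(A; ℚ))`. [cite: Deligne1982HodgeCycles, §4 p. 30]
[cite: DeligneMilne1982Tannakian, §6 Thm. 6.20] -/
theorem exists_conj_baseChange_eq_smul_pullbackOne (a : Module.End ℚ (bettiCohomology A.X 1))
    (ha : a ∈ (BettiUniverse.hodge exists_isReal_hodgeModel_holds (AbelianVariety.isSmoothProjective_holds (A := A)) 1).endAlg) :
    ∃ (c : ℚ) (F : A ⟶ A),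
      (ofRatClassBaseChangeEquiv (AbelianVariety.isSmoothProjective_holds (A := A)) 1).conj (a.baseChange ℂ) =
        (c : ℂ) • pullbackOne A F := by
  have hXA : IsSmoothProjective A.dim A.X := AbelianVariety.isSmoothProjective_holds
  set β := ofRatClassBaseChangeEquiv hXA 1 with hβdef
  have hβpull : ∀ (F : A ⟶ A) (y : ℂ ⊗[ℚ] bettiCohomology A.X 1),
      β ((BettiUniverse.pull F.hom.hom.hom 1).baseChange ℂ y) = pullbackOne A F (β y) :=
    fun F y => (complexBetti_map_ofRatClassBaseChangeEquiv hXA hXA F.hom.hom.hom y).symm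
  obtain ⟨e₀, he₀⟩ := (mem_endAlg_hodge_one_iff_exists_bettiRep exists_isReal_hodgeModel_holds
    hodgePQ_independent_of_hodgeModel_holds a).1 ha
  obtain ⟨c, F₀, hcF⟩ := exists_unop_bettiRep_eq_smul_pull e₀
  have ha_eq : a = c • BettiUniverse.pull F₀.hom.hom.hom 1 := by rw [← he₀, hcF]
  refine ⟨c, F₀, LinearMap.ext fun x => ?_⟩
  rw [LinearEquiv.conj_apply_apply, LinearMap.smul_apply, ha_eq, LinearMap.baseChange_smul, LinearMap.smul_apply,
    ← algebraMap_smul ℂ c, map_smul, hβpull, LinearEquiv.apply_symm_apply, eq_ratCast]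

/-- Pull-backs transported: `β ∘ (v^* ⊗ ℂ) ∘ β⁻¹ = v^*` on `H¹(A(ℂ); ℂ)`. [cite: VoisinHodgeI2002, §7.1.1] -/
theorem conj_baseChange_pull_eq_pullbackOne (v : A ⟶ A) :
    (ofRatClassBaseChangeEquiv (AbelianVariety.isSmoothProjective_holds (A := A)) 1).conj
        ((BettiUniverse.pull v.hom.hom.hom 1).baseChange ℂ) = pullbackOne A v := by
  have hXA : IsSmoothProjective A.dim A.X := AbelianVariety.isSmoothProjective_holds
  refine LinearMap.ext fun x => ?_
  rw [LinearEquiv.conj_apply_apply]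
  have h := (complexBetti_map_ofRatClassBaseChangeEquiv hXA hXA v.hom.hom.hom
    ((ofRatClassBaseChangeEquiv hXA 1).symm x)).symm
  rw [LinearEquiv.apply_symm_apply] at h
  exact h

/-- **A central Hodge endomorphism, transported, commutes with every pull-back.** [cite: Deligne1982HodgeCycles, §4 p. 30] -/
theorem conj_baseChange_comm_pullbackOne (a : Module.End ℚ (bettiCohomology A.X 1))
    (hac : ∀ b ∈ (BettiUniverse.hodge exists_isReal_hodgeModel_holds (AbelianVariety.isSmoothProjective_holds (A := A)) 1).endAlg,
      a * b = b * a) (v : A ⟶ A) :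
    pullbackOne A v * (ofRatClassBaseChangeEquiv (AbelianVariety.isSmoothProjective_holds (A := A)) 1).conj (a.baseChange ℂ) =
      (ofRatClassBaseChangeEquiv (AbelianVariety.isSmoothProjective_holds (A := A)) 1).conj (a.baseChange ℂ) * pullbackOne A v := by
  have hv : BettiUniverse.pull v.hom.hom.hom 1 ∈
      (BettiUniverse.hodge exists_isReal_hodgeModel_holds (AbelianVariety.isSmoothProjective_holds (A := A)) 1).endAlg := by
    have h := unop_bettiRep_mem_endAlg exists_isReal_hodgeModel_holds hodgePQ_independent_of_hodgeModel_holds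
      (AbelianVariety.endAlgebra.of A v)
    rwa [bettiRep_of, MulOpposite.unop_op] at h
  have hcomm := hac _ hv
  rw [← conj_baseChange_pull_eq_pullbackOne v, Module.End.mul_eq_comp, Module.End.mul_eq_comp, ← LinearEquiv.conj_comp,
    ← LinearEquiv.conj_comp, ← Module.End.mul_eq_comp, ← Module.End.mul_eq_comp, ← LinearMap.baseChange_mul,
    ← LinearMap.baseChange_mul, hcomm]

/-- **THE WEIL-TYPE LINK, PROVED (sharp form).** For `φ ∈ End(A)` with monic irreducible integral polynomial `P`, `P(φ) = 0`,
every central pull-back a polynomial in `φ^*` («centre `⊆ ℚ(φ)`») and BALANCED multiplicities `n_ρ = n_ρ̄` at the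
roots of `P`, the `Θ`-trace condition holds: a central Hodge endomorphism `a` of `H¹(A; ℚ)` transports to
`g = c · F^* = p(φ^*)` on `H¹(A(ℂ); ℂ) = ⊕_ρ V_ρ` (`φ^*` semisimple), `Θ` transports to `T = ± 1` on `H^{1,0}`,
`H^{0,1}`, and `tr(Θ ∘ a_ℂ) = tr(T g) = Σ_ρ p(ρ) (n_ρ - n'_ρ)` with `n'_ρ = dim (V_ρ ∩ H^{0,1}) = n_ρ̄ = n_ρ`.
(The Weil-type numerics `e · 2m = 2 dim A`, `m ≠ 0` and the Rosati-skewness of `a` are not needed.)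
[cite: MoonenZarhin1998WeilClasses, §1 Criterion and Remark (1) after Criterion (2)]
[cite: Deligne1982HodgeCycles, I §4 Prop. 4.4 and its proof] [cite: vanGeemen1994HodgeAV, 4.9] -/
theorem hodgeThetaTraceCondition_of_balanced {φ : A ⟶ A} {P : Polynomial ℤ} (hPm : P.Monic)
    (hPirr : Irreducible (P.map (Int.castRingHom ℚ)))
    (hφ : Polynomial.eval₂ (Int.castRingHom (CategoryTheory.End A)) (φ : CategoryTheory.End A) P = 0)
    (hE : ∀ u : A ⟶ A, pullbackOne A u ∈ centralizerAlgebra A → pullbackOne A u ∈ Algebra.adjoin ℂ {pullbackOne A φ})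
    (hbal : ∀ ρ : ℂ, Polynomial.eval₂ (Int.castRingHom ℂ) ρ P = 0 →
      eigenMultiplicity A φ ρ = eigenMultiplicity A φ (starRingEnd ℂ ρ)) :
    HodgeThetaTraceCondition A := by
  intro ψ Θ hΘ a ha hac _hskew
  classical
  have hXA : IsSmoothProjective A.dim A.X := AbelianVariety.isSmoothProjective_holds
  haveI := finite_complexBetti_abelianVariety A 1
  set β := ofRatClassBaseChangeEquiv hXA 1 with hβdef
  -- (1) the transported endomorphism `g = β a_ℂ β⁻¹ = c • F₀^*`, commuting with all pull-backs, a polynomial in `φ^*`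
  set g : Module.End ℂ (complexBetti A.X 1) := β.conj (a.baseChange ℂ) with hgdef
  obtain ⟨c, F₀, hg_eq⟩ := exists_conj_baseChange_eq_smul_pullbackOne a ha
  have hg_comm : ∀ v : A ⟶ A, pullbackOne A v * g = g * pullbackOne A v := conj_baseChange_comm_pullbackOne a hac
  have hg_adj : g ∈ Algebra.adjoin ℂ {pullbackOne A φ} := by
    by_cases hc : c = 0
    · have h0 : g = 0 := by rw [hgdef, hg_eq, hc, Rat.cast_zero, zero_smul]
      rw [h0]; exact zero_mem _
    · have hF₀ : pullbackOne A F₀ ∈ centralizerAlgebra A := by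
        rw [Milne1999.mem_centralizerAlgebra_iff]
        intro v
        have h := hg_comm v
        rw [hgdef, hg_eq, mul_smul_comm, smul_mul_assoc] at h
        exact smul_right_injective _ (by exact_mod_cast hc : (c : ℂ) ≠ 0) h
      rw [hgdef, hg_eq]
      exact Subalgebra.smul_mem _ (hE F₀ hF₀) _
  obtain ⟨p, hp⟩ : ∃ p : ℂ[X], aeval (pullbackOne A φ) p = g := by
    rw [Algebra.adjoin_singleton_eq_range_aeval, AlgHom.mem_range] at hg_adj
    exact hg_adj
  -- (2) `φ^*` is semisimple: `H¹ = ⊕_{P(ρ) = 0} V_ρ`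
  have hP0 : P ≠ 0 := hPm.ne_zero
  have hsepC : (P.map (Int.castRingHom ℂ)).Separable := by
    rw [map_castRingHom_complex_eq]; exact hPirr.separable.map
  have hF0 : aeval (pullbackOne A φ) (P.map (Int.castRingHom ℂ)) = 0 := aeval_hom_complexBetti_map_one_eq_zero hφ
  have hss : (pullbackOne A φ).IsSemisimple := Module.End.isSemisimple_of_squarefree_aeval_eq_zero hsepC.squarefree hF0
  have htop : ⨆ μ, (pullbackOne A φ).eigenspace μ = ⊤ := hss.iSup_eigenspace_eq_top
  have hroot : ∀ μ, (pullbackOne A φ).eigenspace μ ≠ ⊥ → Polynomial.eval₂ (Int.castRingHom ℂ) μ P = 0 := by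
    intro μ hμ
    obtain ⟨v, hv, hv0⟩ := (Submodule.ne_bot_iff _).1 hμ
    have h := Module.End.aeval_apply_of_hasEigenvector (f := pullbackOne A φ) (p := P.map (Int.castRingHom ℂ))
      (Module.End.hasEigenvector_iff.2 ⟨hv, hv0⟩)
    rw [hF0, LinearMap.zero_apply, Polynomial.eval_map] at h
    exact (smul_eq_zero.1 h.symm).resolve_right hv0
  let Z : Finset ℂ := (P.map (Int.castRingHom ℂ)).roots.toFinset
  have hZ : ∀ μ, μ ∈ Z ↔ Polynomial.eval₂ (Int.castRingHom ℂ) μ P = 0 := mem_roots_toFinset_map_iff hP0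
  let V : Z → Submodule ℂ (complexBetti A.X 1) := fun ρ => (pullbackOne A φ).eigenspace (ρ : ℂ)
  have hind : iSupIndep V := (Module.End.eigenspaces_iSupIndep (pullbackOne A φ)).comp Subtype.val_injective
  have hsup : iSup V = ⊤ := by
    refine le_antisymm le_top ?_
    rw [← htop]
    refine iSup_le fun μ => ?_
    by_cases hμ : (pullbackOne A φ).eigenspace μ = ⊥
    · rw [hμ]; exact bot_le
    · exact le_iSup V ⟨μ, (hZ μ).2 (hroot μ hμ)⟩
  have hint : DirectSum.IsInternal V := DirectSum.isInternal_submodule_of_iSupIndep_of_iSup_eq_top hind hsup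
  -- `g` acts on `V_ρ` by the scalar `p(ρ)`
  have hgV : ∀ (ρ : ℂ), ∀ v ∈ (pullbackOne A φ).eigenspace ρ, g v = p.eval ρ • v := by
    intro ρ v hv
    rw [← hp]
    by_cases hv0 : v = 0
    · rw [hv0, map_zero, smul_zero]
    · exact Module.End.aeval_apply_of_hasEigenvector (Module.End.hasEigenvector_iff.2 ⟨hv, hv0⟩)
  -- (3) the transported grading operator `T = β Θ β⁻¹ = ± 1` on `H^{1,0}`, `H^{0,1}`
  set T : Module.End ℂ (complexBetti A.X 1) := β.conj Θ with hTdef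
  have hβ10 : ∀ y, y ∈ (BettiUniverse.hodge exists_isReal_hodgeModel_holds hXA 1).piece ((1 : ℕ) : ℤ) ((0 : ℕ) : ℤ) ↔
      β y ∈ hodgeOneZero hXA := fun y =>
    (BettiUniverse.mem_hodge_piece_iff exists_isReal_hodgeModel_holds hodgePQ_independent_of_hodgeModel_holds hXA
      (k := 1) (p := 1) (q := 0) rfl y).trans (mem_hodgeOneZero hXA).symm
  have hβ01 : ∀ y, y ∈ (BettiUniverse.hodge exists_isReal_hodgeModel_holds hXA 1).piece ((0 : ℕ) : ℤ) ((1 : ℕ) : ℤ) ↔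
      β y ∈ hodgeZeroOne hXA := fun y =>
    (BettiUniverse.mem_hodge_piece_iff exists_isReal_hodgeModel_holds hodgePQ_independent_of_hodgeModel_holds hXA
      (k := 1) (p := 0) (q := 1) rfl y).trans (mem_hodgeZeroOne hXA).symm
  have hT10 : ∀ x ∈ hodgeOneZero hXA, T x = x := by
    intro x hx
    have hy : β.symm x ∈ (BettiUniverse.hodge exists_isReal_hodgeModel_holds hXA 1).piece 1 (((1 : ℕ) : ℤ) - 1) := by
      have h := (hβ10 (β.symm x)).2 (by rw [LinearEquiv.apply_symm_apply]; exact hx)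
      simpa using h
    have h := hΘ 1 (β.symm x) hy
    rw [hTdef, LinearEquiv.conj_apply_apply, h, map_smul, LinearEquiv.apply_symm_apply]
    norm_num
  have hT01 : ∀ x ∈ hodgeZeroOne hXA, T x = -x := by
    intro x hx
    have hy : β.symm x ∈ (BettiUniverse.hodge exists_isReal_hodgeModel_holds hXA 1).piece 0 (((1 : ℕ) : ℤ) - 0) := by
      have h := (hβ01 (β.symm x)).2 (by rw [LinearEquiv.apply_symm_apply]; exact hx)
      simpa using h
    have h := hΘ 0 (β.symm x) hy
    rw [hTdef, LinearEquiv.conj_apply_apply, h, map_smul, LinearEquiv.apply_symm_apply]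
    norm_num [neg_one_smul]
  -- `T` preserves every `V_ρ = (V_ρ ∩ H^{1,0}) ⊕ (V_ρ ∩ H^{0,1})`
  have hTV : ∀ ρ : ℂ, ∀ v ∈ (pullbackOne A φ).eigenspace ρ, T v ∈ (pullbackOne A φ).eigenspace ρ := by
    intro ρ v hv
    have hv' : v ∈ (pullbackOne A φ).eigenspace ρ ⊓ hodgeOneZero hXA ⊔ (pullbackOne A φ).eigenspace ρ ⊓ hodgeZeroOne hXA := by
      rw [← eigenspace_eq_sup hXA φ.hom.hom.hom ρ]; exact hv
    obtain ⟨y, hy, z, hz, rfl⟩ := Submodule.mem_sup.1 hv'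
    rw [map_add, hT10 _ (Submodule.mem_inf.1 hy).2, hT01 _ (Submodule.mem_inf.1 hz).2]
    exact Submodule.add_mem _ (Submodule.mem_inf.1 hy).1 (Submodule.neg_mem _ (Submodule.mem_inf.1 hz).1)
  -- (4) `tr(Θ ∘ a_ℂ) = tr(T g) = Σ_ρ tr((T g)|V_ρ) = Σ_ρ p(ρ) · tr(T|V_ρ) = Σ_ρ p(ρ) · (n_ρ - n'_ρ) = 0`
  have htrconj : LinearMap.trace ℂ _ (Θ * a.baseChange ℂ) = LinearMap.trace ℂ _ (T * g) := by
    rw [← LinearMap.trace_conj' (Θ * a.baseChange ℂ) β, Module.End.mul_eq_comp, LinearEquiv.conj_comp,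
      ← Module.End.mul_eq_comp]
  have hmaps : ∀ ρ : Z, Set.MapsTo (T * g) (V ρ) (V ρ) := by
    intro ρ v hv
    simp only [SetLike.mem_coe] at hv ⊢
    rw [Module.End.mul_apply, hgV _ v hv, map_smul]
    exact Submodule.smul_mem _ _ (hTV _ v hv)
  rw [htrconj, LinearMap.trace_eq_sum_trace_restrict hint hmaps]
  refine Finset.sum_eq_zero fun ρ _ => ?_
  have hTmaps : Set.MapsTo T (V ρ) (V ρ) := fun v hv => hTV _ v hv
  have hres : (T * g).restrict (hmaps ρ) = (p.eval (ρ : ℂ)) • T.restrict hTmaps := by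
    refine LinearMap.ext fun v => Subtype.ext ?_
    simp only [LinearMap.smul_apply, Submodule.coe_smul, LinearMap.coe_restrict_apply, Module.End.mul_apply]
    rw [hgV _ _ v.2, map_smul]
  -- `tr(T|V_ρ) = n_ρ - n'_ρ = 0`
  have htr : LinearMap.trace ℂ (V ρ) (T.restrict hTmaps) = 0 := by
    let N : Bool → Submodule ℂ (V ρ) := fun b =>
      cond b (Submodule.comap (V ρ).subtype (V ρ ⊓ hodgeOneZero hXA)) (Submodule.comap (V ρ).subtype (V ρ ⊓ hodgeZeroOne hXA))
    have hNt_mem : ∀ x : V ρ, x ∈ N true ↔ (x : complexBetti A.X 1) ∈ hodgeOneZero hXA := fun x => by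
      simp only [N, cond_true, Submodule.mem_comap, Submodule.subtype_apply, Submodule.mem_inf]
      exact ⟨fun h => h.2, fun h => ⟨x.2, h⟩⟩
    have hNf_mem : ∀ x : V ρ, x ∈ N false ↔ (x : complexBetti A.X 1) ∈ hodgeZeroOne hXA := fun x => by
      simp only [N, cond_false, Submodule.mem_comap, Submodule.subtype_apply, Submodule.mem_inf]
      exact ⟨fun h => h.2, fun h => ⟨x.2, h⟩⟩
    have hNint : DirectSum.IsInternal N := by
      refine (DirectSum.isInternal_submodule_iff_isCompl N (i := true) (j := false) (by decide) ?_).2 ⟨?_, ?_⟩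
      · ext b; cases b <;> simp
      · rw [Submodule.disjoint_def]
        intro x hx1 hx2
        have h : (x : complexBetti A.X 1) ∈ hodgeOneZero hXA ⊓ hodgeZeroOne hXA :=
          Submodule.mem_inf.2 ⟨(hNt_mem x).1 hx1, (hNf_mem x).1 hx2⟩
        rw [hodgeOneZero_inf_hodgeZeroOne, Submodule.mem_bot] at h
        exact_mod_cast h
      · rw [codisjoint_iff, Submodule.eq_top_iff']
        intro x
        have hx : (x : complexBetti A.X 1) ∈ (pullbackOne A φ).eigenspace ρ ⊓ hodgeOneZero hXA ⊔
            (pullbackOne A φ).eigenspace ρ ⊓ hodgeZeroOne hXA := by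
          rw [← eigenspace_eq_sup hXA φ.hom.hom.hom ρ]; exact x.2
        obtain ⟨y, hy, z, hz, hyz⟩ := Submodule.mem_sup.1 hx
        rw [Submodule.mem_sup]
        refine ⟨⟨y, (Submodule.mem_inf.1 hy).1⟩, (hNt_mem _).2 (Submodule.mem_inf.1 hy).2,
          ⟨z, (Submodule.mem_inf.1 hz).1⟩, (hNf_mem _).2 (Submodule.mem_inf.1 hz).2, Subtype.ext ?_⟩
        simpa using hyz
    have hNmaps : ∀ b, Set.MapsTo (T.restrict hTmaps) (N b) (N b) := by
      intro b x hx
      simp only [SetLike.mem_coe] at hx ⊢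
      cases b with
      | false =>
        rw [hNf_mem] at hx ⊢
        rw [LinearMap.coe_restrict_apply, hT01 _ hx]
        exact Submodule.neg_mem _ hx
      | true =>
        rw [hNt_mem] at hx ⊢
        rw [LinearMap.coe_restrict_apply, hT10 _ hx]
        exact hx
    have hNt : (T.restrict hTmaps).restrict (hNmaps true) = LinearMap.id := by
      refine LinearMap.ext fun x => Subtype.ext (Subtype.ext ?_)
      simp only [LinearMap.coe_restrict_apply, LinearMap.id_coe, id_eq]
      exact hT10 _ ((hNt_mem _).1 x.2)
    have hNf : (T.restrict hTmaps).restrict (hNmaps false) = -LinearMap.id := by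
      refine LinearMap.ext fun x => Subtype.ext (Subtype.ext ?_)
      simp only [LinearMap.coe_restrict_apply, LinearMap.neg_apply, LinearMap.id_coe, id_eq, Submodule.coe_neg]
      exact hT01 _ ((hNf_mem _).1 x.2)
    have h1 : Module.finrank ℂ (N true) = eigenMultiplicity A φ ρ := by
      change Module.finrank ℂ (Submodule.comap (V ρ).subtype (V ρ ⊓ hodgeOneZero hXA)) = _
      rw [LinearEquiv.finrank_eq (Submodule.comapSubtypeEquivOfLe inf_le_left)]
      rfl
    have h2 : Module.finrank ℂ (N false) = eigenMultiplicity A φ (starRingEnd ℂ ρ) := by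
      change Module.finrank ℂ (Submodule.comap (V ρ).subtype (V ρ ⊓ hodgeZeroOne hXA)) = _
      rw [LinearEquiv.finrank_eq (Submodule.comapSubtypeEquivOfLe inf_le_left)]
      have h := finrank_eigenspace_inf_hodgeZeroOne_eq hXA φ.hom.hom.hom (starRingEnd ℂ (ρ : ℂ))
      rw [Complex.conj_conj] at h
      exact h
    have htt : LinearMap.trace ℂ (N true) ((T.restrict hTmaps).restrict (hNmaps true)) = (Module.finrank ℂ (N true) : ℂ) := by
      rw [hNt, LinearMap.trace_id]
    have htf : LinearMap.trace ℂ (N false) ((T.restrict hTmaps).restrict (hNmaps false)) =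
        -(Module.finrank ℂ (N false) : ℂ) := by
      rw [hNf]
      exact (map_neg (LinearMap.trace ℂ (N false)) (LinearMap.id : N false →ₗ[ℂ] N false)).trans
        (by rw [LinearMap.trace_id])
    rw [LinearMap.trace_eq_sum_trace_restrict hNint hNmaps, Fintype.sum_bool, htt, htf, h1, h2, hbal ρ ((hZ ρ).1 ρ.2),
      add_neg_cancel]
  rw [hres, map_smul, htr, smul_zero]


/-- **`WeilTypeThetaTraceLink` holds** (the Prop of this section, with the hypotheses of the tree's
`hasSemisimpleHodgeGroup_of_forall_eigenMultiplicity_eq`; `e · 2m = 2 dim A` and `m ≠ 0` are not used).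
[cite: MoonenZarhin1998WeilClasses, §1 Criterion and Remark (1) after Criterion (2)] -/
theorem weilTypeThetaTraceLink_holds : WeilTypeThetaTraceLink :=
  fun _A _φ _P _e _m hPm _ hPirr hφ _ _ hE hbal => hodgeThetaTraceCondition_of_balanced hPm hPirr hφ hE hbal

/-- **`WeilTypeThetaTraceLink` holds — under the exact discharge name `<Fact>_holds`** of the fact census (the proof is
`weilTypeThetaTraceLink_holds` above). [cite: MoonenZarhin1998WeilClasses, §1 Criterion and Remark (1) after Criterion (2)] -/
theorem WeilTypeThetaTraceLink_holds : WeilTypeThetaTraceLink :=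
  weilTypeThetaTraceLink_holds

variable {φ : A ⟶ A} {P : Polynomial ℤ} {e m : ℕ}

/-- **The Weil-type product row against the link** (HONEST FRAMING as above): HC_CM, the link, Weil-type data with
balanced multiplicities, HC(`A`) and `C` of CM type ⟹ HC(`A × C`). Compare the tree's row through
`Gordon1999_hodgeClassesProductSpan_of_semisimple` + `hasSemisimpleHodgeGroup_of_forall_eigenMultiplicity_eq`: the
printed splitting fact `hG` is no longer a binder. [cite: Lombardo2016, Lemma 3.4 (p. 1229)]
[cite: MoonenZarhin1998WeilClasses, §1 Remark (1) after Criterion (2)] [cite: Milne1999, §7 p. 72] -/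
theorem hodgeConjectureFor_prod_weilType_of_link_of_cmHodgeHypothesis (hL : WeilTypeThetaTraceLink)
    (hCM : ∀ Y : AbelianVariety ℂ, Milne1999.CMHodgeHypothesisAt Y) (hPm : P.Monic) (hPe : P.natDegree = e)
    (hPirr : Irreducible (P.map (Int.castRingHom ℚ)))
    (hφ : Polynomial.eval₂ (Int.castRingHom (CategoryTheory.End A)) (φ : CategoryTheory.End A) P = 0)
    (her : e * (2 * m) = 2 * A.dim) (hm : m ≠ 0)
    (hE : ∀ u : A ⟶ A, pullbackOne A u ∈ centralizerAlgebra A → pullbackOne A u ∈ Algebra.adjoin ℂ {pullbackOne A φ})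
    (hbal : ∀ ρ : ℂ, Polynomial.eval₂ (Int.castRingHom ℂ) ρ P = 0 →
      eigenMultiplicity A φ ρ = eigenMultiplicity A φ (starRingEnd ℂ ρ))
    (C : AbelianVariety ℂ) (hCt : Milne1999.IsOfCMType C) (hA : HodgeConjectureFor A.dim A.X) :
    HodgeConjectureFor (A.prod C).dim (A.prod C).X :=
  hodgeConjectureFor_prod_of_thetaTrace_of_cmHodgeHypothesis hCM A C (hL A φ P e m hPm hPe hPirr hφ her hm hE hbal)
    hCt hA

/-- **The Weil-type product row, NO printed-fact binder** (HONEST FRAMING as above): HC_CM, `φ ∈ End(A)` with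
irreducible integral polynomial `P`, `P(φ) = 0`, centre of `End⁰(A)` inside `ℚ(φ)` (every central pull-back a
polynomial in `φ^*`), balanced multiplicities, HC(`A`) and `C` of CM type ⟹ HC(`A × C`). The tree's earlier row needed
`hG : Gordon1999_hodgeClassesProductSpan_of_semisimple` and `hA : HasSemisimpleHodgeGroup A`; neither is a binder here —
that fact is BYPASSED on this class, NOT discharged (no `_holds`); the earlier row stands as typed.
[cite: Lombardo2016, Lemma 3.4 (p. 1229)] [cite: MoonenZarhin1998WeilClasses, §1 Remark (1) after Criterion (2)]
[cite: Milne1999, §7 p. 72] -/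
theorem hodgeConjectureFor_prod_weilType_of_cmHodgeHypothesis
    (hCM : ∀ Y : AbelianVariety ℂ, Milne1999.CMHodgeHypothesisAt Y) (hPm : P.Monic)
    (hPirr : Irreducible (P.map (Int.castRingHom ℚ)))
    (hφ : Polynomial.eval₂ (Int.castRingHom (CategoryTheory.End A)) (φ : CategoryTheory.End A) P = 0)
    (hE : ∀ u : A ⟶ A, pullbackOne A u ∈ centralizerAlgebra A → pullbackOne A u ∈ Algebra.adjoin ℂ {pullbackOne A φ})
    (hbal : ∀ ρ : ℂ, Polynomial.eval₂ (Int.castRingHom ℂ) ρ P = 0 →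
      eigenMultiplicity A φ ρ = eigenMultiplicity A φ (starRingEnd ℂ ρ))
    (C : AbelianVariety ℂ) (hCt : Milne1999.IsOfCMType C) (hA : HodgeConjectureFor A.dim A.X) :
    HodgeConjectureFor (A.prod C).dim (A.prod C).X :=
  hodgeConjectureFor_prod_of_thetaTrace_of_cmHodgeHypothesis hCM A C (hodgeThetaTraceCondition_of_balanced hPm hPirr hφ hE hbal)
    hCt hA

end WeilTypeLink

end Literature.AlgebraicGeometry.HodgeTheory

end
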